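import Summits.QuantumAdvantage.QuantumAdvantage.Theorems.HolonomyDialPrefix
import Summits.QuantumAdvantage.AdviceFreeQNC0.RingRotation

/-!
# HolonomyDial — Arc (cell decomp-qadv, seat lens-2, generation 13; supports item 26531 `ExactnessDial.PolyLossOddU3`)

§P part P4 + §R (v6): the Prop `PrefixLoss3`, `deg_cert_le`, `prefixLoss3_of_holAvoidLoss3`, **`prefixLoss3 : PrefixLoss3`**, the constant-loss Prop-free form `prefix_hard_polylog` (`2^{n-1} ≤ 32·#{odd losers}`), `laws_proved`; rotation conjugation (`arcOff`, `rot_unrot`, `tGuess_rot`, `ind_rot_mem₃`, `rotStrat`, `rotStrat_mem`, `rel_rotStrat_iff`, `oddZeros_rot'`), the Prop `ArcLoss3`, `arcLoss3_of_prefixLoss3`, `arc_hard_polylog`, `arcLoss3_iff_prefixLoss3`, **`arcLoss3 : ArcLoss3`**, `laws_proved₅`.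

Split (≤ 400 lines, part 13/13) of the node file `HOME/decomp-qadv-lens-2/g13/HolonomyDial.lean` (v6, sha256 47e78a64…,
farm rc 0, no placeholders); declarations verbatim, namespace `Summit.QuantumAdvantage.QuantumAdvantage.Theorems.HolonomyDial`.
Record: NODE-g13.md.
-/

set_option linter.dupNamespace false

noncomputable section
open scoped Classical

namespace Summit.QuantumAdvantage.QuantumAdvantage.Theorems

open Finset
open Literature.Computability.QuantumComplexity Literature.Computability.QuantumComplexity.RingHLF
open Literature.Computability.MetaComplexity Literature.Computability.MetaComplexity.Smolensky
open Summit.QuantumAdvantage.AdviceFreeQNC0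
open Summit.QuantumAdvantage.QuantumAdvantage.Theses (ExactnessDial.PolyLossOddU3 ExactnessDial.NoPerfectOdd3
  ExactnessDial.NoPerfectConst3 ExactnessDial.MassStep3u ExactnessDial.OddToAll3 ExactnessDial.DPLift3
  ExactnessDial.MultiRingBridge3 ExactnessDial.closes)

namespace HolonomyDial

section Prefix

variable {N : ℕ}

/-! ### P4  the prefix law -/

/-- piece `PrefixLoss3` [support · LAW · PROVED (`prefixLoss3`, from `HolAvoidLoss3`)]: no polylog-degree strategy
that deviates from the canonical guess only at positions `k < (log₂ n)^c` wins the `p = 3` ring game on more than a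
`(1 − n^{-C})` fraction of the odd class. -/
def PrefixLoss3 : Prop :=
  ∃ C : ℕ, ∀ c : ℕ, ∃ n₀ : ℕ, ∀ n ≥ n₀, ∀ P : Fin n → CubeFn (ZMod 3) n,
    (∀ i, P i ∈ lowDeg (ZMod 3) n ((Nat.log 2 n) ^ c)) →
    (∀ x : Fin n → Bool, ∀ i : Fin n, (Nat.log 2 n) ^ c ≤ i.val → decide (P i x = 1) = tGuess x i) →
      ((univ.filter fun x : Fin n → Bool =>
          OddZeros x ∧ Rel x (fun i => decide (P i x = 1))).card : ℝ) ≤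
        (1 - 1 / (n : ℝ) ^ C) * (2 : ℝ) ^ (n - 1)

/-- degree bookkeeping: `4K(3K+2) ≤ L^{2c+5}` for `K = L^c`, `L ≥ 2`. -/
theorem deg_cert_le (L c : ℕ) (hL : 2 ≤ L) :
    (L ^ c + L ^ c) * ((L ^ c + L ^ c + 2 + L ^ c) + (L ^ c + L ^ c + 2 + L ^ c)) ≤ L ^ (2 * c + 5) := by
  have hD : 1 ≤ L ^ c := Nat.one_le_pow _ _ (by omega)
  have h5 : 32 ≤ L ^ 5 := by
    calc 32 = 2 ^ 5 := by norm_num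
      _ ≤ L ^ 5 := Nat.pow_le_pow_left hL 5
  have e : L ^ (2 * c + 5) = L ^ c * L ^ c * L ^ 5 := by ring
  rw [e]
  have h1 : L ^ c * L ^ c * 32 ≤ L ^ c * L ^ c * L ^ 5 := Nat.mul_le_mul_left _ h5
  have h2 : L ^ c ≤ L ^ c * L ^ c := Nat.le_mul_of_pos_left _ hD
  nlinarith [h1, h2, hD]

/-- **PREFIX LAW from the crux.** -/
theorem prefixLoss3_of_holAvoidLoss3 (hA : HolAvoidLoss3) : PrefixLoss3 := by
  obtain ⟨C, hC⟩ := hA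
  refine ⟨C, fun c => ?_⟩
  obtain ⟨n₁, hn₁⟩ := hC (2 * c + 5)
  obtain ⟨n₂, hn₂⟩ := TubePlanProof.logPow_le_natSqrt c
  refine ⟨max (max n₁ n₂) 4, fun n hn P hP hpre => ?_⟩
  have hn1 : n₁ ≤ n := le_trans (le_trans (le_max_left _ _) (le_max_left _ _)) hn
  have hn2 : n₂ ≤ n := le_trans (le_trans (le_max_right _ _) (le_max_left _ _)) hn
  have hn4 : 4 ≤ n := le_trans (le_max_right _ _) hn
  have hK : (Nat.log 2 n) ^ c ≤ n := le_trans (hn₂ n hn2) (Nat.sqrt_le_self n)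
  have hlog : 2 ≤ Nat.log 2 n := Nat.le_log_of_pow_le (by norm_num) (by norm_num; omega)
  have hcert : certP ((Nat.log 2 n) ^ c) hK P ∈ lowDeg (ZMod 3) n ((Nat.log 2 n) ^ (2 * c + 5)) :=
    lowDeg_mono (deg_cert_le (Nat.log 2 n) c hlog) (certP_mem hK hP)
  refine le_trans ?_ (hn₁ n hn1 _ hcert)
  have hsub : (univ.filter fun x : Fin n → Bool => OddZeros x ∧ Rel x (fun i => decide (P i x = 1))) ⊆
      (univ.filter fun x : Fin n → Bool =>
        OddZeros x ∧ certP ((Nat.log 2 n) ^ c) hK P x ≠ ((hol x : ℕ) : ZMod 3)) := by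
    intro x hx
    rw [mem_filter] at hx ⊢
    exact ⟨hx.1, hx.2.1, certP_ne_hol _ hK P (by omega) x hx.2.1 (hpre x) hx.2.2⟩
  exact_mod_cast card_le_card hsub

/-- **PREFIX LAW PROVED** (v6): bets confined to the `(log₂ n)^c`-prefix lose a `1/n` fraction of the odd class. -/
theorem prefixLoss3 : PrefixLoss3 := prefixLoss3_of_holAvoidLoss3 holAvoidLoss3

/-- **constant-loss, Prop-free form of the prefix law**: for `n ≥ n₀(c)` every `(log₂ n)^c`-prefix bet of degree
`(log₂ n)^c` LOSES on at least `2^{n-1}/32` odd inputs (its certificate polynomial hits the holonomy there,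
`avoid_hard_polylog`). -/
theorem prefix_hard_polylog (c : ℕ) : ∃ n₀ : ℕ, ∀ n ≥ n₀, ∀ P : Fin n → CubeFn (ZMod 3) n,
    (∀ i, P i ∈ lowDeg (ZMod 3) n ((Nat.log 2 n) ^ c)) →
    (∀ x : Fin n → Bool, ∀ i : Fin n, (Nat.log 2 n) ^ c ≤ i.val → decide (P i x = 1) = tGuess x i) →
      2 ^ (n - 1) ≤ 32 * (univ.filter fun x : Fin n → Bool =>
        OddZeros x ∧ ¬ Rel x (fun i => decide (P i x = 1))).card := by
  obtain ⟨n₁, hn₁⟩ := avoid_hard_polylog (2 * c + 5)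
  obtain ⟨n₂, hn₂⟩ := TubePlanProof.logPow_le_natSqrt c
  refine ⟨max (max n₁ n₂) 4, fun n hn P hP hpre => ?_⟩
  have hn1 : n₁ ≤ n := le_trans (le_trans (le_max_left _ _) (le_max_left _ _)) hn
  have hn2 : n₂ ≤ n := le_trans (le_trans (le_max_right _ _) (le_max_left _ _)) hn
  have hn4 : 4 ≤ n := le_trans (le_max_right _ _) hn
  have hK : (Nat.log 2 n) ^ c ≤ n := le_trans (hn₂ n hn2) (Nat.sqrt_le_self n)
  have hlog : 2 ≤ Nat.log 2 n := Nat.le_log_of_pow_le (by norm_num) (by norm_num; omega)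
  have hcert : certP ((Nat.log 2 n) ^ c) hK P ∈ lowDeg (ZMod 3) n ((Nat.log 2 n) ^ (2 * c + 5)) :=
    lowDeg_mono (deg_cert_le (Nat.log 2 n) c hlog) (certP_mem hK hP)
  refine le_trans (hn₁ n hn1 _ hcert).1 (Nat.mul_le_mul_left _ (card_le_card fun x hx => ?_))
  rw [mem_filter] at hx ⊢
  exact ⟨hx.1, hx.2.1, fun hrel => certP_ne_hol _ hK P (by omega) x hx.2.1 (hpre x) hrel hx.2.2⟩

/-- the four laws of the node, all PROVED: DECODE, SEPARATE, AVOID, PREFIX. -/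
theorem laws_proved : HolDecodeLoss3 ∧ BinPointerLoss3 ∧ HolAvoidLoss3 ∧ PrefixLoss3 :=
  ⟨holDecodeLoss3, binPointerLoss3, holAvoidLoss3, prefixLoss3⟩

end Prefix

/-! ## §R  The ARC LAW (v6): by rotation covariance the losing prefix may be ANY fixed arc of the cycle

The ring game is rotation covariant (tree `RingSymmetry.rel_rot`, `Rel (rot k x) (rot k z) ↔ Rel x z`), the odd
/-- HolonomyDialArc helper `is` (decomp-qadv land package; see the module docstring). -/
class is rotation invariant and `lowDeg` is stable under coordinate permutations; conjugating a strategy by the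
rotation that moves the arc `[s, s+K)` (indices mod `n`) to the prefix `[0, K)` turns `PrefixLoss3` into the
**ARC LAW** `arcLoss3`: a polylog-degree `𝔽₃`-strategy whose deviations from the canonical guess are confined, on
every input, to ONE FIXED arc of length `K = (log₂ n)^c` loses a `1/n` fraction of the odd class.  Contrapositive
(the localisation of `T`'s residual, sharpened): a strategy beating loss `1/n` deviates, for EVERY arc of length
`(log₂ n)^c`, outside that arc on some input — its deviations cannot be pinned to any short window of the ring.
-/

section Arc

variable {N : ℕ}

open Summit.QuantumAdvantage.AdviceFreeQNC0.RingSymmetry (shift rot_rot rot_mul_self rot_apply shift_nxt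
  rot_injective rel_rot card_filter_shift rot_eq_comp)

/-- offset of position `i` from the arc start `s` on the `N`-cycle (`i - s  (mod N)`). -/
def arcOff (N s : ℕ) (i : Fin N) : ℕ := (i.val + (N - s % N)) % N

/-- HolonomyDialArc helper `arcOff_shift` (decomp-qadv land package; see the module docstring). -/
theorem arcOff_shift (hN : 0 < N) (s : ℕ) (b : Fin N) : arcOff N s (shift N s b) = b.val := by
  have hs : s % N < N := Nat.mod_lt _ hN
  show ((b.val + s) % N + (N - s % N)) % N = b.val
  rw [Nat.add_mod b.val s N, Nat.mod_eq_of_lt b.isLt, Nat.mod_add_mod,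
    show b.val + s % N + (N - s % N) = b.val + N by omega, Nat.add_mod_right, Nat.mod_eq_of_lt b.isLt]

/-- the inverse rotation. -/
theorem rot_unrot (hN : 0 < N) (s : ℕ) (y : Fin N → Bool) : rot s (rot (N - s % N) y) = y := by
  rw [rot_rot]
  have h1 := Nat.div_add_mod s N
  have h2 : s % N < N := Nat.mod_lt s hN
  have e : s + (N - s % N) = N * (s / N + 1) := by
    rw [Nat.mul_add, mul_one]
    generalize N * (s / N) = t at h1 ⊢
    omega
  rw [e, rot_mul_self]

/-- HolonomyDialArc helper `unrot_rot` (decomp-qadv land package; see the module docstring). -/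
theorem unrot_rot (hN : 0 < N) (s : ℕ) (x : Fin N → Bool) : rot (N - s % N) (rot s x) = x := by
  rw [rot_rot, Nat.add_comm, ← rot_rot]
  exact rot_unrot hN s x

/-- the canonical guess is rotation covariant. -/
theorem tGuess_rot (s : ℕ) (x : Fin N → Bool) (b : Fin N) : tGuess (rot s x) b = tGuess x (shift N s b) := by
  unfold tGuess
  rw [rot_apply, rot_apply, shift_nxt]

/-- a coordinate of a rotated pattern is a coordinate (degree `≤ 1`; cf. tree `RingPeriodFold.ind_rot_mem'`). -/
theorem ind_rot_mem₃ (k : ℕ) (j : Fin N) :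
    (fun u : Fin N → Bool => if rot k u j = true then (1 : ZMod 3) else 0) ∈ lowDeg (ZMod 3) N 1 := by
  have e : (fun u : Fin N → Bool => if rot k u j = true then (1 : ZMod 3) else 0) =
      mono (ZMod 3) ({shift N k j} : Finset (Fin N)) := by
    funext u
    rw [mono_apply]
    simp [rot_eq_comp]
  rw [e]
  exact mono_mem_lowDeg (by simp)

/-- the strategy conjugated by the rotation `s`: component `b` reads `P_{b+s}` on the un-rotated input. -/
def rotStrat (s : ℕ) (P : Fin N → CubeFn (ZMod 3) N) : Fin N → CubeFn (ZMod 3) N :=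
  fun b y => P (shift N s b) (rot (N - s % N) y)

/-- HolonomyDialArc helper `rotStrat_mem` (decomp-qadv land package; see the module docstring). -/
theorem rotStrat_mem {D : ℕ} {P : Fin N → CubeFn (ZMod 3) N} (hP : ∀ i, P i ∈ lowDeg (ZMod 3) N D)
    (s : ℕ) (b : Fin N) : rotStrat s P b ∈ lowDeg (ZMod 3) N D :=
  Smolensky.comp_mem_lowDeg_of_coord (F := ZMod 3) (rot (N - s % N)) (fun j => ind_rot_mem₃ _ j) (hP _)

/-- HolonomyDialArc helper `rotStrat_rot` (decomp-qadv land package; see the module docstring). -/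
theorem rotStrat_rot (hN : 0 < N) (s : ℕ) (P : Fin N → CubeFn (ZMod 3) N) (x : Fin N → Bool) (b : Fin N) :
    rotStrat s P b (rot s x) = P (shift N s b) x := by
  show P (shift N s b) (rot (N - s % N) (rot s x)) = _
  rw [unrot_rot hN]

/-- the win set is transported by the rotation: `x` wins for `P` iff `rot s x` wins for the conjugate. -/
theorem rel_rotStrat_iff (hN : 0 < N) (s : ℕ) (P : Fin N → CubeFn (ZMod 3) N) (x : Fin N → Bool) :
    Rel (rot s x) (fun b => decide (rotStrat s P b (rot s x) = 1)) ↔ Rel x (fun i => decide (P i x = 1)) := by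
  have e : (fun b => decide (rotStrat s P b (rot s x) = 1)) = rot s (fun i => decide (P i x = 1)) := by
    funext b
    rw [rotStrat_rot hN, rot_apply]
  rw [e]
  exact rel_rot s x _

/-- the odd class is rotation invariant (cf. tree `RingMinor.oddZeros_rot`). -/
theorem oddZeros_rot' (s : ℕ) (x : Fin N → Bool) : OddZeros (rot s x) ↔ OddZeros x := by
  unfold OddZeros
  rw [show (univ.filter fun b : Fin N => rot s x b = false) = (univ.filter fun b : Fin N => x (shift N s b) = false)
    from rfl, card_filter_shift s (fun b => x b = false)]

/-- **Prop R.** The ARC LAW: deviations confined to one fixed arc `{i : arcOff n s i < (log₂ n)^c}` lose. -/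
def ArcLoss3 : Prop :=
  ∃ C : ℕ, ∀ c : ℕ, ∃ n₀ : ℕ, ∀ n ≥ n₀, ∀ s : ℕ, ∀ P : Fin n → CubeFn (ZMod 3) n,
    (∀ i, P i ∈ lowDeg (ZMod 3) n ((Nat.log 2 n) ^ c)) →
    (∀ x : Fin n → Bool, ∀ i : Fin n, (Nat.log 2 n) ^ c ≤ arcOff n s i → decide (P i x = 1) = tGuess x i) →
      ((univ.filter fun x : Fin n → Bool =>
          OddZeros x ∧ Rel x (fun i => decide (P i x = 1))).card : ℝ) ≤
        (1 - 1 / (n : ℝ) ^ C) * (2 : ℝ) ^ (n - 1)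

/-- the arc `s = 0` is the prefix: `ArcLoss3 → PrefixLoss3`. -/
theorem prefixLoss3_of_arcLoss3 (h : ArcLoss3) : PrefixLoss3 := by
  obtain ⟨C, hC⟩ := h
  refine ⟨C, fun c => ?_⟩
  obtain ⟨n₀, hn₀⟩ := hC c
  refine ⟨n₀, fun n hn P hP hdev => hn₀ n hn 0 P hP fun x i hi => hdev x i ?_⟩
  have hn' : 0 < n := i.pos
  have : arcOff n 0 i = i.val := by
    unfold arcOff
    rw [Nat.zero_mod, Nat.sub_zero, Nat.add_mod_right, Nat.mod_eq_of_lt i.isLt]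
  omega

/-- **ARC LAW from the PREFIX LAW** (same exponent `C`, same threshold), by conjugating with the rotation `s`. -/
theorem arcLoss3_of_prefixLoss3 (h : PrefixLoss3) : ArcLoss3 := by
  obtain ⟨C, hC⟩ := h
  refine ⟨C, fun c => ?_⟩
  obtain ⟨n₀, hn₀⟩ := hC c
  refine ⟨n₀, fun n hn s P hP hdev => ?_⟩
  rcases Nat.eq_zero_or_pos n with h0 | hN
  · subst h0
    exact hn₀ 0 hn P hP fun x i => i.elim0
  -- the conjugated strategy is a prefix bet of the same degree
  have hQ : ∀ b, rotStrat s P b ∈ lowDeg (ZMod 3) n ((Nat.log 2 n) ^ c) := rotStrat_mem hP s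
  have hQdev : ∀ y : Fin n → Bool, ∀ b : Fin n, (Nat.log 2 n) ^ c ≤ b.val →
      decide (rotStrat s P b y = 1) = tGuess y b := by
    intro y b hb
    have ey : y = rot s (rot (n - s % n) y) := (rot_unrot hN s y).symm
    have h1 := hdev (rot (n - s % n) y) (shift n s b) (by rw [arcOff_shift hN]; exact hb)
    have h2 : tGuess y b = tGuess (rot (n - s % n) y) (shift n s b) := by
      conv_lhs => rw [ey]
      exact tGuess_rot s _ b
    rw [h2, ← h1]
    rfl
  have hbound := hn₀ n hn (rotStrat s P) hQ hQdev
  -- transport the win set along `x ↦ rot s x`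
  have hle : (univ.filter fun x : Fin n → Bool => OddZeros x ∧ Rel x (fun i => decide (P i x = 1))).card ≤
      (univ.filter fun y : Fin n → Bool => OddZeros y ∧ Rel y (fun b => decide (rotStrat s P b y = 1))).card := by
    refine Finset.card_le_card_of_injOn (fun x => rot s x) (fun x hx => ?_) (fun x _ x' _ h => rot_injective s h)
    rw [mem_coe, mem_filter] at hx
    rw [mem_coe, mem_filter]
    exact ⟨mem_univ _, (oddZeros_rot' s x).2 hx.2.1, (rel_rotStrat_iff hN s P x).2 hx.2.2⟩
  exact le_trans (by exact_mod_cast hle) hbound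

/-- **constant-loss, Prop-free form of the arc law**: for `n ≥ n₀(c)`, every strategy of degree `(log₂ n)^c` whose
deviations are confined to the arc `{i : arcOff n s i < (log₂ n)^c}` LOSES on at least `2^{n-1}/32` odd inputs. -/
theorem arc_hard_polylog (c : ℕ) : ∃ n₀ : ℕ, ∀ n ≥ n₀, ∀ s : ℕ, ∀ P : Fin n → CubeFn (ZMod 3) n,
    (∀ i, P i ∈ lowDeg (ZMod 3) n ((Nat.log 2 n) ^ c)) →
    (∀ x : Fin n → Bool, ∀ i : Fin n, (Nat.log 2 n) ^ c ≤ arcOff n s i → decide (P i x = 1) = tGuess x i) →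
      2 ^ (n - 1) ≤ 32 * (univ.filter fun x : Fin n → Bool =>
        OddZeros x ∧ ¬ Rel x (fun i => decide (P i x = 1))).card := by
  obtain ⟨n₀, hn₀⟩ := prefix_hard_polylog c
  refine ⟨max n₀ 1, fun n hn s P hP hdev => ?_⟩
  have hn0 : n₀ ≤ n := le_trans (le_max_left _ _) hn
  have hN : 0 < n := lt_of_lt_of_le Nat.zero_lt_one (le_trans (le_max_right _ _) hn)
  have hQ : ∀ b, rotStrat s P b ∈ lowDeg (ZMod 3) n ((Nat.log 2 n) ^ c) := rotStrat_mem hP s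
  have hQdev : ∀ y : Fin n → Bool, ∀ b : Fin n, (Nat.log 2 n) ^ c ≤ b.val →
      decide (rotStrat s P b y = 1) = tGuess y b := by
    intro y b hb
    have ey : y = rot s (rot (n - s % n) y) := (rot_unrot hN s y).symm
    have h1 := hdev (rot (n - s % n) y) (shift n s b) (by rw [arcOff_shift hN]; exact hb)
    have h2 : tGuess y b = tGuess (rot (n - s % n) y) (shift n s b) := by
      conv_lhs => rw [ey]
      exact tGuess_rot s _ b
    rw [h2, ← h1]
    rfl
  refine le_trans (hn₀ n hn0 (rotStrat s P) hQ hQdev) (Nat.mul_le_mul_left _ ?_)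
  -- transport the LOSS set back along `y ↦ rot (n - s % n) y`, i.e. forward along the bijection `x ↦ rot s x`
  have hsurj : Function.Surjective (rot (n := n) s) := Finite.surjective_of_injective (rot_injective s)
  refine Finset.card_le_card_of_surjOn (fun x => rot s x) fun y hy => ?_
  obtain ⟨x, rfl⟩ := hsurj y
  rw [mem_coe, mem_filter] at hy
  refine ⟨x, ?_, rfl⟩
  rw [mem_coe, mem_filter]
  exact ⟨mem_univ _, (oddZeros_rot' s x).1 hy.2.1, fun h => hy.2.2 ((rel_rotStrat_iff hN s P x).2 h)⟩

/-- `ArcLoss3 ⟺ PrefixLoss3`. -/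
theorem arcLoss3_iff_prefixLoss3 : ArcLoss3 ↔ PrefixLoss3 := ⟨prefixLoss3_of_arcLoss3, arcLoss3_of_prefixLoss3⟩

/-- **ARC LAW PROVED** (v6): deviations confined to any one fixed arc of length `(log₂ n)^c` lose `1/n` of the odd class. -/
theorem arcLoss3 : ArcLoss3 := arcLoss3_of_prefixLoss3 prefixLoss3

/-- the five laws of the node, all PROVED: DECODE, SEPARATE, AVOID, PREFIX, ARC. -/
theorem laws_proved₅ : HolDecodeLoss3 ∧ BinPointerLoss3 ∧ HolAvoidLoss3 ∧ PrefixLoss3 ∧ ArcLoss3 :=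
  ⟨holDecodeLoss3, binPointerLoss3, holAvoidLoss3, prefixLoss3, arcLoss3⟩

end Arc

end HolonomyDial

end Summit.QuantumAdvantage.QuantumAdvantage.Theorems
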